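import Summits.QuantumAdvantage.AdviceFreeQNC0.FibreDecimation37NH
import Summits.QuantumAdvantage.AdviceFreeQNC0.FibreDecimation37NHS
import Summits.QuantumAdvantage.AdviceFreeQNC0.FibreDecimation37GenD
import Summits.QuantumAdvantage.AdviceFreeQNC0.FibreDecimation37MOne
import HarnessLib

/-!
# Cell qa-qnc0, `p = 3` — ROUND-37P2's three fibre theorems, RE-TYPED with `3 ≤ m` (P2-38h (1): "the fix is the one-line hypothesis
# `3 ≤ m →` after `Odd m →`") and DISCHARGED

Planner qa-qnc0-p2 g37 typed `Exp37.FibreNonExact37` / `FibreNonExact37NH` / `FibreNonExact37NHS` (`FibreDecimation37.lean`, all odd `m`);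
the first two are FALSE at `m = 1` (`not_fibreNonExact37`, `not_fibreNonExact37NH`, `FibreDecimation37MOne.lean`) and all three are PROVED
for `m ≥ 3` (`fibreNonExact37_of_three_le`, `fibreNonExact37NH_of_three_le`, `fibreNonExact37NHS_of_three_le`).  Planner p2 g38 agreed
(P2-38h) that the typed targets must carry `3 ≤ m`; p2 is in custody (no proposals) and the typed file is append-only, so the corrected
statements are recorded HERE, verbatim except for the inserted hypothesis, each with its `_holds` theorem:

* `FibreNonExact37Three` / `fibreNonExact37Three_holds` (Theorem 37.F, constant targets, (Gen_d));
* `FibreNonExact37NHThree` / `fibreNonExact37NHThree_holds` (Theorem 37.F′, affine targets, (NH));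
* `FibreNonExact37NHSThree` / `fibreNonExact37NHSThree_holds` (§3.8 (ii), mixed population, (NH/S));
* bookkeeping: `typed_targets_status` records `¬ FibreNonExact37 ∧ ¬ FibreNonExact37NH ∧ FibreNonExact37Three ∧ …`.

WHAT THIS IS NOT: nothing new is proved here; crux 22907 untouched; no separation claim.
-/

noncomputable section

namespace Summit.QuantumAdvantage.AdviceFreeQNC0.Exp37

open Finset
open Summit.QuantumAdvantage.AdviceFreeQNC0 F4

/-- **Theorem 37.F (constant target), re-typed with `3 ≤ m`.**  Verbatim `FibreNonExact37` plus the hypothesis `3 ≤ m`. -/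
def FibreNonExact37Three : Prop :=
  ∀ (z s m d : ℕ) (ι : Fin m ↪ Fin z) (β : Fin s → Fin z → ZMod 3) (r : Fin s → ZMod 3) (k₀ : Fin s)
    (a : Fin m → Bool),
    Odd m → 3 ≤ m → 1 ≤ z - m →
    (∀ i, β k₀ (ι i) = lettZ (a i)) →
    GenD ι a β d →
    ∀ (ε b : ℕ), (((coset z ε).filter fun u => testParity β r u = b % 2).card : ℝ)
        ≤ (1 - (2 : ℝ)⁻¹ ^ (m + 2)) * (2 : ℝ) ^ (z - 1)

/-- **Theorem 37.F′ (affine target, (NH)), re-typed with `3 ≤ m`.**  Verbatim `FibreNonExact37NH` plus the hypothesis `3 ≤ m`. -/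
def FibreNonExact37NHThree : Prop :=
  ∀ (z s m : ℕ) (ι : Fin m ↪ Fin z) (β : Fin s → Fin z → ZMod 3) (r : Fin s → ZMod 3) (k₀ : Fin s)
    (a : Fin m → Bool),
    Odd m → 3 ≤ m → 1 ≤ z - m →
    (∀ i, β k₀ (ι i) = lettZ (a i)) →
    NHCond ι a β →
    ∀ (ε μ₀ : ℕ) (S : Finset (Fin z)),
      (((coset z ε).filter fun u => testParity β r u % 2 = affTarget μ₀ S u % 2).card : ℝ)
        ≤ (1 - (2 : ℝ)⁻¹ ^ (m + 3)) * (2 : ℝ) ^ (z - 1)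

/-- **§3.8 (ii) (mixed population, (NH/S)), re-typed with `3 ≤ m`.**  Verbatim `FibreNonExact37NHS` plus the hypothesis `3 ≤ m`. -/
def FibreNonExact37NHSThree : Prop :=
  ∀ (z s m R : ℕ) (ι : Fin m ↪ Fin z) (β : Fin s → Fin z → ZMod 3) (r : Fin s → ZMod 3) (k₀ : Fin s)
    (a : Fin m → Bool) (S : Fin R → Fin z → ZMod 3) (h : (Fin R → ZMod 3) → Bool),
    Odd m → 3 ≤ m → 1 ≤ z - m →
    (∀ i, β k₀ (ι i) = lettZ (a i)) →
    NHSCond ι a β S →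
    ∀ (ε μ₀ : ℕ) (T : Finset (Fin z)),
      (((coset z ε).filter fun u =>
          (testParity β r u + (if h (labelVal S u) then 1 else 0)) % 2 = affTarget μ₀ T u % 2).card : ℝ)
        ≤ (1 - (2 : ℝ)⁻¹ ^ (m + 3)) * (2 : ℝ) ^ (z - 1)

/-- **Theorem 37.F (re-typed) — DISCHARGED.** -/
theorem fibreNonExact37Three_holds : FibreNonExact37Three :=
  fun z s m d ι β r k₀ a hm h3 hz hβ hG ε b => fibreNonExact37_of_three_le z s m d ι β r k₀ a hm h3 hz hβ hG ε b

/-- **Theorem 37.F′ (re-typed) — DISCHARGED.** -/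
theorem fibreNonExact37NHThree_holds : FibreNonExact37NHThree :=
  fun z s m ι β r k₀ a hm h3 hz hβ hNH ε μ₀ S => fibreNonExact37NH_of_three_le z s m ι β r k₀ a hm h3 hz hβ hNH ε μ₀ S

/-- **§3.8 (ii) (re-typed) — DISCHARGED.** -/
theorem fibreNonExact37NHSThree_holds : FibreNonExact37NHSThree :=
  fun z s m R ι β r k₀ a S h hm h3 hz hβ hNHS ε μ₀ T =>
    fibreNonExact37NHS_of_three_le z s m R ι β r k₀ a S h hm h3 hz hβ hNHS ε μ₀ T

/-- **Status of p2 g37's typed fibre targets**: the two un-restricted statements are false (m = 1), the `3 ≤ m` statements hold. -/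
theorem typed_targets_status :
    ¬ FibreNonExact37 ∧ ¬ FibreNonExact37NH ∧ FibreNonExact37Three ∧ FibreNonExact37NHThree ∧ FibreNonExact37NHSThree :=
  ⟨not_fibreNonExact37, not_fibreNonExact37NH, fibreNonExact37Three_holds, fibreNonExact37NHThree_holds,
    fibreNonExact37NHSThree_holds⟩

end Summit.QuantumAdvantage.AdviceFreeQNC0.Exp37

end
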